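import Literature.NumberTheory.EllipticCurves.HeegnerPointsKolyvaginSquares
import Literature.NumberTheory.EllipticCurves.BinaryQuarticGoodReductionSolubilityProofs
import Mathlib.LinearAlgebra.Trace
import HarnessLib

/-!
# Trace candidates in `Aut((ℤ/p)²)`: for ANY injective additive `M` one of
# `tr M`, `tr (M u)`, `tr (M u')`, `tr (M u u')` is non-zero, and the shears `u, u'` are commutators

Helper file for crux `stmt-BirchSwinnertonDyer-19715`, line `aux_norm_receptacle`, stub S3♭
`stub_auxiliaryPrimeSupply` — step (F3a), pure-algebra half (seat bsd-line-er5-p1-w2 g5). Theorems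
only, Mathlib + the tree's `KolyvaginImage` shears (`HeegnerPointsKolyvaginSquares`); nothing here is
specific to elliptic curves and nothing closes 19715.

For an abelian group `T` with an additive isomorphism `e : T ≃+ (ℤ/p)²` (`p` prime) and the
`ℤ/p`-linear trace `tr f` of an additive `f : T → T`:
* `trace_toZModLinearMap_eq` — `tr f = (e f e⁻¹ e₀)₀ + (e f e⁻¹ e₁)₁`;
* `exists_trace_comp_ne_zero` — for an INJECTIVE additive `M : T → T`, with `u = e⁻¹ (shearX 1) e`,
  `u' = e⁻¹ (shearY 1) e`: `tr M ≠ 0 ∨ tr (M u) ≠ 0 ∨ tr (M u') ≠ 0 ∨ tr (M u u') ≠ 0` (if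
  `M ↔ (a b; c d)` the four traces are `a+d`, `a+c+d`, `a+b+d`, `2a+b+c+d`; all zero forces `M = 0`);
* `exists_shearX_one_eq_comm`, `exists_shearY_one_eq_comm` — for `p ≥ 5` the shears `shearX 1`,
  `shearY 1` are commutators `D S D⁻¹ S⁻¹` of additive automorphisms of `(ℤ/p)²`
  (`D = diag(2, 2⁻¹)`, `S = shearX 3⁻¹`, resp. `diag(2⁻¹, 2)`, `shearY 3⁻¹`), stated pointwise.
These feed the construction of a Frobenius witness `γ = c₀ · [x,y][x',y'] ∈ Γ_ℚ` with
`tr ρ̄_{E,p}(γ) ≠ 0` (Gross 1991 §9 uses `𝒢 = Gal(ℚ(E_p)/ℚ) ≅ GL₂(ℤ/p)` in the same way).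

References: B. H. Gross, *Kolyvagin's work on modular elliptic curves*, LMS LNS 153 (1991), §9
[GrossLMS1991]; J.-P. Serre, Invent. Math. 15 (1972), §2 [Serre1972].
-/

noncomputable section

set_option linter.dupNamespace false -- `Summit.BirchSwinnertonDyer.BirchSwinnertonDyer` (summit = problem), tree-wide

open scoped Classical
open Literature.NumberTheory.EllipticCurves Literature.NumberTheory.EllipticCurves.KolyvaginImage

namespace Summit.BirchSwinnertonDyer.BirchSwinnertonDyer.Theorems.AuxPrimeSupply

variable {p : ℕ} [Fact p.Prime] {T : Type*} [AddCommGroup T] [Module (ZMod p) T]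

/-! ### The trace through the frame `e` -/

/-- **The `ℤ/p`-trace of an additive endomorphism of `T ≃ (ℤ/p)²` read off the frame `e`:**
`tr f = (e f e⁻¹ e₀)₀ + (e f e⁻¹ e₁)₁` (trace = sum of the diagonal matrix entries in the basis
`e⁻¹ e₀, e⁻¹ e₁`, Mathlib `LinearMap.trace_eq_matrix_trace`, `Module.Basis.ofEquivFun`). [folklore] -/
theorem trace_toZModLinearMap_eq (e : T ≃+ (Fin 2 → ZMod p)) (f : T →+ T) :
    LinearMap.trace (ZMod p) T (f.toZModLinearMap p) =
      e (f (e.symm (Pi.single 0 1))) 0 + e (f (e.symm (Pi.single 1 1))) 1 := by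
  set ε : T ≃ₗ[ZMod p] (Fin 2 → ZMod p) :=
    LinearEquiv.ofBijective (e.toAddMonoidHom.toZModLinearMap p) e.bijective with hε
  have hεe : ∀ x, ε x = e x := fun x ↦ rfl
  have hεs : ∀ y, ε.symm y = e.symm y := fun y ↦ by
    rw [LinearEquiv.symm_apply_eq, hεe, AddEquiv.apply_symm_apply]
  set b := Module.Basis.ofEquivFun ε with hb
  rw [LinearMap.trace_eq_matrix_trace (ZMod p) b, Matrix.trace_fin_two, LinearMap.toMatrix_apply,
    LinearMap.toMatrix_apply, Module.Basis.ofEquivFun_repr_apply, Module.Basis.ofEquivFun_repr_apply,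
    Module.Basis.coe_ofEquivFun]
  simp only [hεs, hεe, AddMonoidHom.coe_toZModLinearMap]

/-! ### The four candidates -/

/-- `e₀ = (1, 0)`. [folklore] -/
private theorem single_zero_eq : (Pi.single 0 1 : Fin 2 → ZMod p) = ![1, 0] := by
  ext i; fin_cases i <;> simp

/-- `e₁ = (0, 1)`. [folklore] -/
private theorem single_one_eq : (Pi.single 1 1 : Fin 2 → ZMod p) = ![0, 1] := by
  ext i; fin_cases i <;> simp

/-- **Trace candidates.** For an injective additive `M : T → T` (`T ≃ (ℤ/p)²` via `e`) and the
transported shears `u = e⁻¹ ∘ shearX 1 ∘ e`, `u' = e⁻¹ ∘ shearY 1 ∘ e`, at least one of `tr M`,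
`tr (M u)`, `tr (M u')`, `tr (M u u')` is non-zero: in the frame `e`, `M = (a b; c d)` gives the
four traces `a + d`, `a + c + d`, `a + b + d`, `2a + b + c + d`, whose simultaneous vanishing forces
`a = b = c = d = 0`, i.e. `M e⁻¹e₀ = 0`, contradicting injectivity. [folklore] -/
theorem exists_trace_comp_ne_zero (e : T ≃+ (Fin 2 → ZMod p)) (M : T →+ T)
    (hM : Function.Injective M) :
    LinearMap.trace (ZMod p) T (M.toZModLinearMap p) ≠ 0 ∨
    LinearMap.trace (ZMod p) T
      ((M.comp (transport e (shearX 1)).toAddMonoidHom).toZModLinearMap p) ≠ 0 ∨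
    LinearMap.trace (ZMod p) T
      ((M.comp (transport e (shearY 1)).toAddMonoidHom).toZModLinearMap p) ≠ 0 ∨
    LinearMap.trace (ZMod p) T
      ((M.comp ((transport e (shearX 1)).toAddMonoidHom.comp
        (transport e (shearY 1)).toAddMonoidHom)).toZModLinearMap p) ≠ 0 := by
  -- the entries of `M' = e M e⁻¹`
  set M' : (Fin 2 → ZMod p) →+ (Fin 2 → ZMod p) :=
    e.toAddMonoidHom.comp (M.comp e.symm.toAddMonoidHom) with hM'
  have hM'ap : ∀ v, M' v = e (M (e.symm v)) := fun v ↦ rfl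
  set a := M' ![1, 0] 0 with ha
  set c := M' ![1, 0] 1 with hc
  set b := M' ![0, 1] 0 with hb
  set d := M' ![0, 1] 1 with hd
  -- values of the shears on the frame
  have hX0 : shearX (1 : ZMod p) ![1, 0] = ![1, 0] := by ext i; fin_cases i <;> simp
  have hX1 : shearX (1 : ZMod p) ![0, 1] = ![1, 0] + ![0, 1] := by ext i; fin_cases i <;> simp
  have hY0 : shearY (1 : ZMod p) ![1, 0] = ![1, 0] + ![0, 1] := by ext i; fin_cases i <;> simp
  have hY1 : shearY (1 : ZMod p) ![0, 1] = ![0, 1] := by ext i; fin_cases i <;> simp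
  have hXY0 : shearX (1 : ZMod p) (shearY 1 ![1, 0]) = ![1, 0] + ![1, 0] + ![0, 1] := by
    ext i; fin_cases i <;> (simp; try ring)
  -- the four traces in terms of `a b c d`
  have t1 : LinearMap.trace (ZMod p) T (M.toZModLinearMap p) = a + d := by
    rw [trace_toZModLinearMap_eq e, single_zero_eq, single_one_eq]
    rfl
  have t2 : LinearMap.trace (ZMod p) T
      ((M.comp (transport e (shearX 1)).toAddMonoidHom).toZModLinearMap p) = a + (c + d) := by
    rw [trace_toZModLinearMap_eq e, single_zero_eq, single_one_eq]
    simp only [AddMonoidHom.coe_comp, Function.comp_apply, AddEquiv.coe_toAddMonoidHom,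
      transport_apply, AddEquiv.apply_symm_apply, hX0, hX1]
    rw [← hM'ap, ← hM'ap, map_add, Pi.add_apply]
  have t3 : LinearMap.trace (ZMod p) T
      ((M.comp (transport e (shearY 1)).toAddMonoidHom).toZModLinearMap p) = (a + b) + d := by
    rw [trace_toZModLinearMap_eq e, single_zero_eq, single_one_eq]
    simp only [AddMonoidHom.coe_comp, Function.comp_apply, AddEquiv.coe_toAddMonoidHom,
      transport_apply, AddEquiv.apply_symm_apply, hY0, hY1]
    rw [← hM'ap, ← hM'ap, map_add, Pi.add_apply]
  have t4 : LinearMap.trace (ZMod p) T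
      ((M.comp ((transport e (shearX 1)).toAddMonoidHom.comp
        (transport e (shearY 1)).toAddMonoidHom)).toZModLinearMap p) = (a + a + b) + (c + d) := by
    rw [trace_toZModLinearMap_eq e, single_zero_eq, single_one_eq]
    simp only [AddMonoidHom.coe_comp, Function.comp_apply, AddEquiv.coe_toAddMonoidHom,
      transport_apply, AddEquiv.apply_symm_apply, hY1, hX1, hXY0]
    rw [← hM'ap, ← hM'ap, map_add, map_add, map_add, Pi.add_apply, Pi.add_apply, Pi.add_apply]
  rw [t1, t2, t3, t4]
  by_contra h
  simp only [not_or, ne_eq, not_not] at h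
  obtain ⟨h1, h2, h3, h4⟩ := h
  have ha0 : a = 0 := by linear_combination h4 - h2 - h3 + h1
  have hc0 : c = 0 := by linear_combination h2 - h1
  -- so `M' ![1,0] = 0`, contradicting injectivity
  have hv : M' ![1, 0] = 0 := by
    ext i; fin_cases i
    · exact ha0
    · exact hc0
  rw [hM'ap, ← e.map_zero, e.apply_eq_iff_eq, ← M.map_zero] at hv
  have h0 := hM hv
  rw [← e.symm.map_zero, e.symm.apply_eq_iff_eq] at h0
  have := congrFun h0 0
  simp at this

/-! ### The shears are commutators (`p ∉ {2, 3}`) -/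

/-- **`shearX 1` is a commutator** (`p ≥ 5`): there are additive automorphisms `D` (namely
`diag(2, 2⁻¹)`) and `S = shearX 3⁻¹` of `(ℤ/p)²` with `shearX 1 = D ∘ S ∘ D⁻¹ ∘ S⁻¹`
(`D S D⁻¹ = shearX (4·3⁻¹)`). [folklore] -/
theorem exists_shearX_one_eq_comm (hp5 : 5 ≤ p) :
    ∃ D S : (Fin 2 → ZMod p) ≃+ (Fin 2 → ZMod p), ∀ v : Fin 2 → ZMod p,
      shearX 1 v = D (S (D.symm (S.symm v))) := by
  obtain ⟨h2, h3⟩ := BinaryQuartic.two_three_ne_zero_zmod hp5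
  have hw : (2 : ZMod p) * 2⁻¹ = 1 := mul_inv_cancel₀ h2
  have hs : (3 : ZMod p) * 3⁻¹ = 1 := mul_inv_cancel₀ h3
  let D : (Fin 2 → ZMod p) ≃+ (Fin 2 → ZMod p) :=
    { toFun := fun v ↦ ![2 * v 0, 2⁻¹ * v 1]
      invFun := fun v ↦ ![2⁻¹ * v 0, 2 * v 1]
      left_inv := fun v ↦ by
        ext i; fin_cases i
        · simp; linear_combination (v 0) * hw
        · simp; linear_combination (v 1) * hw
      right_inv := fun v ↦ by
        ext i; fin_cases i
        · simp; linear_combination (v 0) * hw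
        · simp; linear_combination (v 1) * hw
      map_add' := fun v v' ↦ by
        ext i; fin_cases i
        · simp; ring
        · simp; ring }
  refine ⟨D, shearX 3⁻¹, fun v ↦ ?_⟩
  change shearX 1 v = ![2 * (shearX 3⁻¹ ![2⁻¹ * ((shearX 3⁻¹).symm v) 0,
    2 * ((shearX 3⁻¹).symm v) 1]) 0, 2⁻¹ * (shearX 3⁻¹ ![2⁻¹ * ((shearX 3⁻¹).symm v) 0,
    2 * ((shearX 3⁻¹).symm v) 1]) 1]
  have hsymm : (shearX (3⁻¹ : ZMod p)).symm v = ![v 0 - 3⁻¹ * v 1, v 1] := rfl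
  rw [hsymm]
  ext i; fin_cases i
  · simp
    linear_combination (-(v 0 - 3⁻¹ * v 1)) * hw - (v 1) * hs
  · simp
    linear_combination (-(v 1)) * hw

/-- **`shearY 1` is a commutator** (`p ≥ 5`): `shearY 1 = D' ∘ S ∘ D'⁻¹ ∘ S⁻¹` with
`D' = diag(2⁻¹, 2)`, `S = shearY 3⁻¹`. [folklore] -/
theorem exists_shearY_one_eq_comm (hp5 : 5 ≤ p) :
    ∃ D S : (Fin 2 → ZMod p) ≃+ (Fin 2 → ZMod p), ∀ v : Fin 2 → ZMod p,
      shearY 1 v = D (S (D.symm (S.symm v))) := by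
  obtain ⟨h2, h3⟩ := BinaryQuartic.two_three_ne_zero_zmod hp5
  have hw : (2 : ZMod p) * 2⁻¹ = 1 := mul_inv_cancel₀ h2
  have hs : (3 : ZMod p) * 3⁻¹ = 1 := mul_inv_cancel₀ h3
  let D : (Fin 2 → ZMod p) ≃+ (Fin 2 → ZMod p) :=
    { toFun := fun v ↦ ![2⁻¹ * v 0, 2 * v 1]
      invFun := fun v ↦ ![2 * v 0, 2⁻¹ * v 1]
      left_inv := fun v ↦ by
        ext i; fin_cases i
        · simp; linear_combination (v 0) * hw
        · simp; linear_combination (v 1) * hw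
      right_inv := fun v ↦ by
        ext i; fin_cases i
        · simp; linear_combination (v 0) * hw
        · simp; linear_combination (v 1) * hw
      map_add' := fun v v' ↦ by
        ext i; fin_cases i
        · simp; ring
        · simp; ring }
  refine ⟨D, shearY 3⁻¹, fun v ↦ ?_⟩
  change shearY 1 v = ![2⁻¹ * (shearY 3⁻¹ ![2 * ((shearY 3⁻¹).symm v) 0,
    2⁻¹ * ((shearY 3⁻¹).symm v) 1]) 0, 2 * (shearY 3⁻¹ ![2 * ((shearY 3⁻¹).symm v) 0,
    2⁻¹ * ((shearY 3⁻¹).symm v) 1]) 1]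
  have hsymm : (shearY (3⁻¹ : ZMod p)).symm v = ![v 0, v 1 - 3⁻¹ * v 0] := rfl
  rw [hsymm]
  ext i; fin_cases i
  · simp
    linear_combination (-(v 0)) * hw
  · simp
    linear_combination (-(v 1 - 3⁻¹ * v 0)) * hw - (v 0) * hs

end Summit.BirchSwinnertonDyer.BirchSwinnertonDyer.Theorems.AuxPrimeSupply

end
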